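import Literature.AlgebraicGeometry.Resolution.TateJapanese
import Literature.AlgebraicGeometry.Resolution.CoefficientRingsProofs
import Literature.AlgebraicGeometry.Resolution.RegularLocalRingsQuotient
import Literature.AlgebraicGeometry.Resolution.RegularLocalRingsNormal
import Literature.AlgebraicGeometry.Resolution.RegularLocalRingsProofs
import Literature.AlgebraicGeometry.Resolution.FormalFibres
import Literature.AlgebraicGeometry.Resolution.FormalRetractionSection
import Literature.AlgebraicGeometry.Resolution.CompleteLocalDomainJ0
import Mathlib.RingTheory.LocalRing.MaximalIdeal.Square
import Mathlib.RingTheory.KrullDimension.Zero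
import Mathlib.RingTheory.KrullDimension.Field
import HarnessLib

/-!
# Complete Noetherian local domains have finite normalization (Nagata; Stacks 10.162.8, EGA 0_IV 23.1.5)

Topic: `Literature/AlgebraicGeometry/Resolution`. The Stacks Project, Lemma 10.162.8 (Tag 032W):
*"A Noetherian complete local ring is a Nagata ring. Proof. … it suffices to show that a Noetherian
complete local domain `R` is N-2. By Lemmas 10.161.5 and 10.160.11 we reduce to the case
`R = k[[X_1, …, X_d]]` where `k` is a field or `R = Λ[[X_1, …, X_d]]` where `Λ` is a Cohen ring. In
the case `k[[X_1, …, X_d]]` we reduce to the statement that a field is N-2 by Lemma 10.161.17. …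
Applying Lemma 10.161.16 [Tate] once more with `x = p ∈ Λ` we reduce yet again to the case of a
field."* We PROVE the two statements the rest of the tree needs, in the following arrangement of
the same argument (Cohen's structure theorem is used in the form already in the tree,
`Matsumura1987_29_4_iii_holds`: a complete local domain is finite over a complete REGULAR local
subring; and Tate's theorem is applied to a complete regular local ring `S` and a regular parameter
`x ∈ 𝔪 ∖ 𝔪²`, so that `S/xS` is again complete regular local of smaller dimension — for
`S = k[[X]]` resp. `Λ[[X]]` and `x = X_d` resp. `x = p` this is literally the printed induction):

* `module_finite_integralClosure_of_isRegularLocalRing_of_isAdicComplete` — **a complete regular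
  local ring is N-2**: the integral closure in every finite extension of its field of fractions is
  module-finite (induction on the dimension through `TateJapanese.lean`; dimension `0` = fields);
* `module_finite_integralClosure_fractionRing_of_isAdicComplete` — **a complete Noetherian local
  domain is N-1**: its integral closure in its field of fractions is module-finite (Cohen 29.4 (iii)
  and the previous result for the regular subring, transported as in
  `CompleteLocalDomainNormalization.lean`, whose one-dimensional version this generalises).

No definitions, no named facts. Step 4 of the discharge of
`EGAIV2_7_7_4_finiteNormalization_completeLocal` (`FiniteNormalizationCompleteLocalBase.lean`).

## References

* [StacksProject] The Stacks Project, Tag 032W (Lemma 10.162.8), Tag 0BI1 (Lemma 10.161.16).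
* [EGA0IV] A. Grothendieck, J. Dieudonné, EGA IV₁ (Chap. 0), Publ. Math. IHÉS 20 (1964), (23.1.5).
* [Matsumura1987] H. Matsumura, *Commutative Ring Theory*, Thm. 29.4 (iii).
-/

noncomputable section

open IsLocalRing

namespace Literature.AlgebraicGeometry.Resolution

universe u

/-! ## Fields are N-2 -/

/-- A field is N-2: for `S` a field with fraction field `K` (so `S = K`) and `L/K` finite, the
integral closure of `S` in `L` is a finite `S`-module. [cite: StacksProject, Tag 032W (proof: "we
reduce to the statement that a field is N-2 … This is clear")] -/
theorem module_finite_integralClosure_of_isField_of_finiteDimensional {S K L : Type u} [CommRing S] [IsDomain S]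
    (hS : IsField S) [Field K] [Field L] [Algebra S K] [IsFractionRing S K] [Algebra K L]
    [Algebra S L] [IsScalarTower S K L] [FiniteDimensional K L] :
    Module.Finite S (integralClosure S L) := by
  letI := hS.toField
  have hbij : Function.Bijective (algebraMap S K) :=
    IsField.localization_map_bijective (M := nonZeroDivisors S) zero_notMem_nonZeroDivisors hS
  haveI : Module.Finite S K := Module.Finite.of_surjective (Algebra.linearMap S K) hbij.2
  haveI : Module.Finite S L := Module.Finite.trans K L
  exact Module.Finite.of_injective (integralClosure S L).val.toLinearMap Subtype.val_injective

/-! ## Complete regular local rings are N-2 -/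

/-- **A complete regular local ring is N-2** (Stacks 10.162.8, proof, for `k[[X]]` and `Λ[[X]]`
by Tate's Lemma 10.161.16 and induction): for `S` complete regular local of dimension `d` and
every finite extension `L` of a field of fractions `K` of `S`, the integral closure of `S` in `L` is
a finite `S`-module. Induction on `d`: `d = 0` is the field case; for `d ≥ 1` pick
`x ∈ 𝔪 ∖ 𝔪²`, so `S/xS` is complete regular local of dimension `d - 1` (hence an N-2 domain) and
`S` is `x`-adically complete and normal, and apply Tate's theorem.
[cite: StacksProject, Tag 032W (Lemma 10.162.8)] [cite: EGA0IV, (23.1.5)] -/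
theorem module_finite_integralClosure_of_isRegularLocalRing_of_isAdicComplete (d : ℕ) :
    ∀ (S : Type u) [CommRing S] [IsRegularLocalRing S] [IsAdicComplete (maximalIdeal S) S],
      ringKrullDim S = d →
      ∀ (K L : Type u) [Field K] [Field L] [Algebra S K] [IsFractionRing S K] [Algebra K L]
        [Algebra S L] [IsScalarTower S K L] [FiniteDimensional K L],
        Module.Finite S (integralClosure S L) := by
  induction d with
  | zero =>
    intro S _ _ _ hdim K L _ _ _ _ _ _ _ _
    haveI := isDomain_of_isRegularLocalRing S
    haveI : Ring.KrullDimLE 0 S := Ring.krullDimLE_iff.mpr hdim.le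
    exact module_finite_integralClosure_of_isField_of_finiteDimensional (K := K) (Ring.KrullDimLE.isField_of_isDomain (R := S))
  | succ d ih =>
    intro S _ _ _ hdim K L _ _ _ _ _ _ _ _
    haveI := isDomain_of_isRegularLocalRing S
    haveI : IsIntegrallyClosed S := isIntegrallyClosed_of_isRegularLocalRing S
    -- a regular parameter `x ∈ 𝔪 ∖ 𝔪²`
    have hnf : ¬ IsField S := fun hF => by
      have := ringKrullDim_eq_zero_of_isField hF
      rw [hdim] at this
      exact absurd this (by norm_cast)
    obtain ⟨x, hx, hx2⟩ := SetLike.exists_of_lt ((maximalIdeal_sq_lt_maximalIdeal S).mpr hnf)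
    have hx0 : x ≠ 0 := fun h => hx2 (h ▸ Submodule.zero_mem _)
    have hxtop : Ideal.span {x} ≠ ⊤ := Ideal.span_singleton_ne_top ((mem_maximalIdeal x).mp hx)
    haveI := isLocalRing_quotient hxtop
    obtain ⟨hreg, hdimq⟩ := IsRegularLocalRing.quotient_span_singleton hx hx2
    haveI := hreg
    haveI : IsAdicComplete (maximalIdeal (S ⧸ Ideal.span {x})) (S ⧸ Ideal.span {x}) :=
      isAdicComplete_quotient (Ideal.span {x})
    haveI := isDomain_of_isRegularLocalRing (S ⧸ Ideal.span {x})
    have hxp : (Ideal.span {x}).IsPrime := (Ideal.Quotient.isDomain_iff_prime _).mp inferInstance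
    haveI : IsAdicComplete (Ideal.span {x}) S :=
      IsAdicComplete.of_le_of_isNoetherianRing (maximalIdeal S) (Ideal.span {x})
        ((Ideal.span_singleton_le_iff_mem _).mpr hx)
    -- `dim S/xS = d`
    have hdimq' : ringKrullDim (S ⧸ Ideal.span {x}) = d := by
      obtain ⟨n, hn⟩ := exists_nat_cast_eq_ringKrullDim (R := S ⧸ Ideal.span {x})
      rw [hn, hdim] at hdimq
      have : n + 1 = d + 1 := by exact_mod_cast hdimq
      rw [hn]
      exact_mod_cast Nat.succ_injective this
    -- induction hypothesis: `S/xS` is N-2; then Tate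
    have hN2 := ih (S ⧸ Ideal.span {x}) hdimq'
    exact module_finite_integralClosure_of_isAdicComplete_span x hx0 hxp hN2 K L

/-! ## Complete local domains are N-1 -/

variable (D : Type u) [CommRing D] [IsDomain D] [IsLocalRing D] [IsNoetherianRing D]
  [IsAdicComplete (maximalIdeal D) D]

/-- **A complete Noetherian local domain has module-finite normalization** (Nagata; Stacks
10.162.8 / EGA 0_IV (23.1.5), the N-1 part): by Cohen's structure theorem (Matsumura 29.4 (iii),
`Matsumura1987_29_4_iii_holds`) `D` is finite over a complete regular local subring `A`; the
integral closure of `D` in `Frac D` is the integral closure of `A` in the finite extension `Frac D`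
of `Frac A`, finite over `A` by `module_finite_integralClosure_of_isRegularLocalRing_of_isAdicComplete`,
hence over `D`. [cite: StacksProject, Tag 032W (Lemma 10.162.8)] [cite: Matsumura1987, Thm. 29.4 (iii)] -/
theorem module_finite_integralClosure_fractionRing_of_isAdicComplete :
    Module.Finite D (integralClosure D (FractionRing D)) := by
  classical
  obtain ⟨A, hreg, hcomp, hfin⟩ := Matsumura1987_29_4_iii_holds D
  haveI := hreg
  haveI := hcomp
  haveI := hfin
  haveI : FaithfulSMul A D := (faithfulSMul_iff_algebraMap_injective A D).mpr Subtype.val_injective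
  haveI : Algebra.IsIntegral A D := Algebra.IsIntegral.of_finite A D
  obtain ⟨d, hd⟩ := exists_nat_cast_eq_ringKrullDim (R := A)
  -- fraction fields `Frac A ⊆ Frac D`, a finite extension
  haveI : FaithfulSMul A (FractionRing D) := FractionRing.instFaithfulSMul A D
  letI : Algebra (FractionRing A) (FractionRing D) := FractionRing.liftAlgebra A (FractionRing D)
  haveI : FiniteDimensional (FractionRing A) (FractionRing D) :=
    finiteDimensional_fractionRing_of_finite (R := A) (A := D)
  -- the integral closure of `A` in `Frac D` is finite over `A`
  haveI hB : Module.Finite A (integralClosure A (FractionRing D)) :=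
    module_finite_integralClosure_of_isRegularLocalRing_of_isAdicComplete d A hd
      (FractionRing A) (FractionRing D)
  -- and it contains (in fact equals) the integral closure of `D`; transport generators
  obtain ⟨T, hT⟩ := Module.Finite.fg_top (R := A) (M := integralClosure A (FractionRing D))
  have hmemW : ∀ y : integralClosure A (FractionRing D),
      (y : FractionRing D) ∈ integralClosure D (FractionRing D) := fun y =>
    IsIntegral.tower_top (A := D) y.2
  let ι : integralClosure A (FractionRing D) → integralClosure D (FractionRing D) :=
    fun y => ⟨y, hmemW y⟩
  refine Module.finite_def.mpr ⟨T.image ι, ?_⟩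
  rw [eq_top_iff]
  rintro w -
  have hwA : IsIntegral A (w : FractionRing D) := isIntegral_trans (A := D) _ w.2
  have hx : (⟨w, hwA⟩ : integralClosure A (FractionRing D)) ∈
      Submodule.span A (T : Set (integralClosure A (FractionRing D))) := by rw [hT]; trivial
  have hι : ∀ y ∈ Submodule.span A (T : Set (integralClosure A (FractionRing D))),
      ι y ∈ Submodule.span D ((T.image ι : Finset _) : Set (integralClosure D (FractionRing D))) := by
    intro y hy
    refine Submodule.span_induction (p := fun y _ => ι y ∈ Submodule.span D
      ((T.image ι : Finset _) : Set (integralClosure D (FractionRing D)))) ?_ ?_ ?_ ?_ hy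
    · intro y hy
      exact Submodule.subset_span (by rw [Finset.coe_image]; exact ⟨y, hy, rfl⟩)
    · have : ι 0 = 0 := Subtype.ext rfl
      rw [this]; exact Submodule.zero_mem _
    · intro y z _ _ hy hz
      have : ι (y + z) = ι y + ι z := Subtype.ext rfl
      rw [this]; exact Submodule.add_mem _ hy hz
    · intro a y _ hy
      have : ι (a • y) = (a : D) • ι y := Subtype.ext (by
        change ((a • y : integralClosure A (FractionRing D)) : FractionRing D) =
          (a : D) • ((y : integralClosure A (FractionRing D)) : FractionRing D)
        rw [Subalgebra.coe_smul]
        exact (IsScalarTower.algebraMap_smul D a _).symm)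
      rw [this]; exact Submodule.smul_mem _ _ hy
  have := hι _ hx
  have hιw : ι ⟨w, hwA⟩ = w := Subtype.ext rfl
  rwa [hιw] at this

end Literature.AlgebraicGeometry.Resolution

end
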